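import Summits.AtomisticToContinuum.FouriersLaw.Theorems.HonestZwanzigNetworkReductionPackage
import Summits.AtomisticToContinuum.FouriersLaw.Theorems.HonestZwanzigGeneratorSiteEnergy
import Summits.AtomisticToContinuum.FouriersLaw.Theorems.HonestZwanzigParityStatics

/-!
# HonestZwanzig / OrthogonalOhm — the Ward identity `𝔽_N(s) = χ G(s)⁻¹ χ` (stub S1 of line `Sketch`)

Support file for the crux item `stmt-AtomisticToContinuum-12693` (`OrthogonalOhm` of route
`HonestZwanzig`, sub-problem `FouriersLaw`). At fixed `N ≥ 2` and every Laplace variable `s > 0`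
the vertex-memory matrix of the Feshbach block algebra of the thermostatted pinned chain satisfies
`schur_s((L e_x)∘Θ, L e_y) = s·cov(e_x,e_y) + γT²[x = y ∈ ∂] − Σ_{u,v} cov(e_x,e_u) (G(s)⁻¹)_{uv} cov(e_v,e_y)`
(`χ = cov(e,e)`, `G(s) = [lap_s(e_x,e_y)]`), i.e. the route's `𝔽_N(s) = χ G(s)⁻¹ χ` read as an
identity for the vertex memory.

* `OrthogonalOhmLine.stub_wardIdentity.schur_generator_eq` — the identity for ABSTRACT pairings at
  one fixed `s` (pure `Fin N` matrix algebra from the three Kolmogorov identities and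
  `G G⁻¹ = G⁻¹ G = 1`; this is the internal step `𝔽 = C G⁻¹ C` of `circuit_sandwich`).
* `OrthogonalOhmLine.stub_wardIdentity.schur_generator_eq_pkg` — the same for the canonical
  gadgets of the route (implicit variables with defining hypotheses, as in the `NetworkReduction`
  package), using `pkg_K1`–`pkg_K3`, `pkg_G_symm`, positivity of `G(s)` and `ParityStatics`.
* `stub_wardIdentity` — the registered stub signature, from the route item `FeshbachIdentities`
  and the proved items `GeneratorSiteEnergy`, `ParityStatics`.
-/

noncomputable section

open MeasureTheory Finset Real Set Filter ProbabilityTheory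
open Literature.MathematicalPhysics.KineticTheory.HeatConduction

namespace Summit.AtomisticToContinuum.FouriersLaw.Theorems.HonestZwanzig

namespace OrthogonalOhmLine.stub_wardIdentity

open NetworkReduction

/-! ### The abstract identity at one fixed `s` -/

/-- **Ward identity, abstract form.** For abstract pairings `lap, cov` at one fixed `s`, site
observables `e`, `Lf y` (`L e_y`) and `Lr x` (`(L e_x)∘Θ`), an invertible Gram matrix
`G = [lap(e_x,e_y)]` and `schur(f,g) = lap(f,g) − Σ lap(f,e_x) G⁻¹_{xy} lap(e_y,g)`, the three
Kolmogorov identities give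
`schur(Lr x, Lf y) = s·cov(e_x,e_y) − cov(e_x, Lf y) − Σ_{u,v} cov(e_x,e_u) G⁻¹_{uv} cov(e_v,e_y)`. -/
theorem schur_generator_eq {X : Type*} {N : ℕ}
    (lap cov schur : (X → ℝ) → (X → ℝ) → ℝ) (e Lf Lr : Fin N → X → ℝ)
    (G C : Matrix (Fin N) (Fin N) ℝ) (s : ℝ)
    (hG : ∀ x y, G x y = lap (e x) (e y)) (hC : ∀ x y, C x y = cov (e x) (e y))
    (hschur : ∀ f g, schur f g = lap f g - ∑ x, ∑ y, lap f (e x) * G⁻¹ x y * lap (e y) g)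
    (hGG : G * G⁻¹ = 1) (hGG' : G⁻¹ * G = 1)
    (hK1 : ∀ x u, lap (Lr x) (e u) = s * lap (e x) (e u) - cov (e x) (e u))
    (hK2 : ∀ u y, lap (e u) (Lf y) = s * lap (e u) (e y) - cov (e u) (e y))
    (hK3 : ∀ x y, lap (Lr x) (Lf y) = s * (s * lap (e x) (e y) - cov (e x) (e y)) - cov (e x) (Lf y))
    (x y : Fin N) :
    schur (Lr x) (Lf y) = s * cov (e x) (e y) - cov (e x) (Lf y) -
      ∑ u, ∑ v, cov (e x) (e u) * G⁻¹ u v * cov (e v) (e y) := by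
  rw [hschur, hK3]
  have hT : ∀ u v, lap (Lr x) (e u) * G⁻¹ u v * lap (e v) (Lf y) =
      (s • G - C) x u * G⁻¹ u v * (s • G - C) v y := by
    intro u v
    rw [hK1, hK2]
    simp only [Matrix.sub_apply, Matrix.smul_apply, smul_eq_mul, hG, hC]
  have hT' : ∑ u, ∑ v, lap (Lr x) (e u) * G⁻¹ u v * lap (e v) (Lf y) =
      ((s • G - C) * G⁻¹ * (s • G - C)) x y := by
    rw [mul_mul_apply_eq_sum_sum]
    exact Finset.sum_congr rfl fun u _ => Finset.sum_congr rfl fun v _ => hT u v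
  have hmat : (s • G - C) * G⁻¹ * (s • G - C) =
      (s * s) • G - s • C - s • C + C * G⁻¹ * C := by
    have e1 : (s • G - C) * G⁻¹ = s • (1 : Matrix (Fin N) (Fin N) ℝ) - C * G⁻¹ := by
      rw [sub_mul, Matrix.smul_mul, hGG]
    rw [e1, sub_mul, mul_sub, mul_sub, Matrix.smul_mul, Matrix.smul_mul, Matrix.one_mul,
      Matrix.one_mul, smul_smul, Matrix.mul_smul, Matrix.mul_assoc C G⁻¹ G, hGG', Matrix.mul_one]
    abel
  have hCGC : (C * G⁻¹ * C) x y = ∑ u, ∑ v, cov (e x) (e u) * G⁻¹ u v * cov (e v) (e y) := by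
    rw [mul_mul_apply_eq_sum_sum]
    exact Finset.sum_congr rfl fun u _ => Finset.sum_congr rfl fun v _ => by rw [hC, hC]
  rw [hT', hmat]
  simp only [Matrix.add_apply, Matrix.sub_apply, Matrix.smul_apply, smul_eq_mul]
  rw [hG x y, hC x y, hCGC]
  ring

/-! ### The identity for the canonical gadgets of the route -/

section Package

variable {ω₂ lam β γ : ℝ} {N : ℕ} {T : ℝ}
  {Adm : (PhaseSpace N → ℝ) → Prop}
  {corr : (PhaseSpace N → ℝ) → (PhaseSpace N → ℝ) → ℝ → ℝ}
  {lap : ℝ → (PhaseSpace N → ℝ) → (PhaseSpace N → ℝ) → ℝ}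
  {cov : (PhaseSpace N → ℝ) → (PhaseSpace N → ℝ) → ℝ}
  {e : Fin N → PhaseSpace N → ℝ}
  (hAdm : ∀ f, Adm f ↔ (Continuous f ∧ ∃ A : ℝ, ∀ z,
    |f z| ≤ A * Real.exp ((pinnedChain ω₂ lam β γ).hamiltonian N z / (8 * T))))
  (hlap : ∀ s f g, lap s f g = ∫ t in Set.Ioi (0 : ℝ), Real.exp (-(s * t)) * corr f g t)
  (hcov : ∀ f g, cov f g = (∫ z, f z * g z ∂(pinnedChain ω₂ lam β γ).gibbsMeasure N T) -
    (∫ z, f z ∂(pinnedChain ω₂ lam β γ).gibbsMeasure N T) *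
      (∫ z, g z ∂(pinnedChain ω₂ lam β γ).gibbsMeasure N T))
  (he : ∀ x z, e x z = z.2 x ^ 2 / 2 + (pinnedChain ω₂ lam β γ).U (z.1 x) +
    ∑ j : Fin N, ((if j.val = x.val + 1 then (pinnedChain ω₂ lam β γ).V (z.1 j - z.1 x) / 2 else 0) +
      (if x.val = j.val + 1 then (pinnedChain ω₂ lam β γ).V (z.1 x - z.1 j) / 2 else 0)))
  (hFI : ∀ f g : PhaseSpace N → ℝ, Adm f → Adm g →
    Integrable f ((pinnedChain ω₂ lam β γ).gibbsMeasure N T) ∧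
    (∀ t : ℝ, 0 ≤ t → Integrable (fun z => f z *
      (∫ y, g y ∂((pinnedChain ω₂ lam β γ).transitionKernel N T T t.toNNReal z)))
      ((pinnedChain ω₂ lam β γ).gibbsMeasure N T)) ∧
    IntegrableOn (corr f g) (Set.Ioi 0) ∧
    (∀ t : ℝ, 0 ≤ t → corr f g t = corr (fun z => g (z.1, -z.2)) (fun z => f (z.1, -z.2)) t) ∧
    (∀ s : ℝ, 0 < s → ∀ x : Fin N,
      s * lap s (e x) g - cov (e x) g =
        lap s (fun z => (pinnedChain ω₂ lam β γ).generator N T T (e x) (z.1, -z.2)) g ∧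
      s * lap s f (e x) - cov f (e x) = lap s f ((pinnedChain ω₂ lam β γ).generator N T T (e x))))
  (hGSE : ∀ (x : Fin N) (z : PhaseSpace N), (pinnedChain ω₂ lam β γ).generator N T T (e x) z =
    (∑ b : Fin N, ((if x.val = b.val + 1 then (pinnedChain ω₂ lam β γ).bondCurrent N b z else 0) -
      (if b = x then (pinnedChain ω₂ lam β γ).bondCurrent N b z else 0))) +
    (if x.val = 0 then (pinnedChain ω₂ lam β γ).γ * (T - z.2 x ^ 2) else 0) +
    (if x.val = N - 1 then (pinnedChain ω₂ lam β γ).γ * (T - z.2 x ^ 2) else 0))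
  (hPS : ∀ x y : Fin N, cov (e x) ((pinnedChain ω₂ lam β γ).generator N T T (e y)) =
    -(if x = y ∧ (x.val = 0 ∨ x.val = N - 1) then (pinnedChain ω₂ lam β γ).γ * T ^ 2 else 0))
  (hω : 0 < ω₂) (hl : 0 ≤ lam) (hβ : 0 ≤ β) (hT : 0 < T)

include hAdm hlap hcov he hFI hGSE hPS hω hl hβ hT in
/-- **Ward identity for the canonical gadgets at fixed `s > 0`.** With `G = G(s)` (positive, hence
invertible by `pkg_G_symm` and `posDef_of_symm_of_pos`) and the Schur pairing `schur = schur_s`: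
`schur_s((L e_x)∘Θ, L e_y) = s·cov(e_x,e_y) + γT²[x = y ∈ ∂] − Σ_{u,v} cov(e_x,e_u) G⁻¹_{uv} cov(e_v,e_y)`
(Kolmogorov identities `pkg_K1`–`pkg_K3` and `ParityStatics`). -/
theorem schur_generator_eq_pkg {s : ℝ} (hs : 0 < s)
    (G : Matrix (Fin N) (Fin N) ℝ) (hG : ∀ x y, G x y = lap s (e x) (e y))
    (schur : (PhaseSpace N → ℝ) → (PhaseSpace N → ℝ) → ℝ)
    (hschur : ∀ f g, schur f g = lap s f g - ∑ x, ∑ y, lap s f (e x) * G⁻¹ x y * lap s (e y) g)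
    (hGp : ∀ v : Fin N → ℝ, v ≠ 0 → 0 < ∑ x, ∑ y, v x * G x y * v y) (x y : Fin N) :
    schur (fun z => (pinnedChain ω₂ lam β γ).generator N T T (e x) (z.1, -z.2))
        ((pinnedChain ω₂ lam β γ).generator N T T (e y)) =
      s * cov (e x) (e y) +
        (if x = y ∧ (x.val = 0 ∨ x.val = N - 1) then (pinnedChain ω₂ lam β γ).γ * T ^ 2 else 0) -
          ∑ u, ∑ v, cov (e x) (e u) * G⁻¹ u v * cov (e v) (e y) := by
  have hGsym : ∀ x y, G x y = G y x := fun x y => by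
    rw [hG, hG, pkg_G_symm hAdm hlap he hFI hω hl hβ hT s]
  have hGu : IsUnit G.det :=
    (Matrix.isUnit_iff_isUnit_det G).1 (posDef_of_symm_of_pos G hGsym hGp).isUnit
  have h := schur_generator_eq (lap s) cov schur e
    (fun y => (pinnedChain ω₂ lam β γ).generator N T T (e y))
    (fun x z => (pinnedChain ω₂ lam β γ).generator N T T (e x) (z.1, -z.2)) G
    (Matrix.of fun x y => cov (e x) (e y)) s hG (fun _ _ => rfl) hschur
    (Matrix.mul_nonsing_inv G hGu) (Matrix.nonsing_inv_mul G hGu)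
    (pkg_K1 hAdm he hFI hω hl hβ hT hs) (pkg_K2 hAdm he hFI hω hl hβ hT hs)
    (pkg_K3 hAdm hlap hcov he hFI hGSE hPS hω hl hβ hT hs) x y
  rw [h, hPS x y]
  ring

end Package

end OrthogonalOhmLine.stub_wardIdentity

open OrthogonalOhmLine.stub_wardIdentity in
/-- **Stub S1** (`WardIdentity`, support identity of line `Sketch` of the crux `OrthogonalOhm`): the
vertex-memory matrix of the Feshbach block algebra is
`[schur_s((L e_x)∘Θ, L e_y)]_{xy} = s·χ + Γ_b − χ G(s)⁻¹ χ` exactly at every `s > 0`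
(`χ = cov(e,e)`, `Γ_b = γT²(δ₀δ₀ᵀ + δ_{N−1}δ_{N−1}ᵀ)`), i.e. the route's `𝔽_N(s) = χG(s)⁻¹χ` read as an
identity; from the Feshbach package (Kolmogorov identities `pkg_K1`–`pkg_K3`, `G(s)` invertible) and
`ParityStatics` (`cov(e_x, L e_y) = −γT²[x = y ∈ ∂]`). -/
theorem stub_wardIdentity : Summit.AtomisticToContinuum.FouriersLaw.Theses.HonestZwanzig.FeshbachIdentities →
    ∀ ω₂ lam β γ : ℝ, 0 < ω₂ → 0 < lam → 0 < β → 0 < γ → ∀ T : ℝ, 0 < T → ∀ N : ℕ, 2 ≤ N → let P := Literature.MathematicalPhysics.KineticTheory.HeatConduction.pinnedChain ω₂ lam β γ; let X := Literature.MathematicalPhysics.KineticTheory.HeatConduction.PhaseSpace N; let μ : MeasureTheory.Measure X := P.gibbsMeasure N T; let corr : (X → ℝ) → (X → ℝ) → ℝ → ℝ := fun f g t => (∫ z, f z * (∫ y, g y ∂(P.transitionKernel N T T t.toNNReal z)) ∂μ) - (∫ z, f z ∂μ) * (∫ z, g z ∂μ); let lap : ℝ → (X → ℝ) → (X → ℝ)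 → ℝ := fun s f g => ∫ t in Set.Ioi (0 : ℝ), Real.exp (-(s * t)) * corr f g t; let cov : (X → ℝ) → (X → ℝ) → ℝ := fun f g => (∫ z, f z * g z ∂μ) - (∫ z, f z ∂μ) * (∫ z, g z ∂μ); let e : Fin N → X → ℝ := fun x z => z.2 x ^ 2 / 2 + P.U (z.1 x) + ∑ j : Fin N, ((if j.val = x.val + 1 then P.V (z.1 j - z.1 x) / 2 else 0) + (if x.val = j.val + 1 then P.V (z.1 x - z.1 j) / 2 else 0)); let G : ℝ → Matrix (Fin N) (Fin N) ℝ := fun s => Matrix.of fun x y => lap s (e x) (e y); let schur : ℝ → (X → ℝ) → (X → ℝ) → ℝ := fun s f g => lap s f g - ∑ x : Fin N, ∑ y : Fin N, lap s f (e x) * (G s)⁻¹ x y * lap s (e y) g; ∀ s : ℝ, 0 < s → ∀ x y : Fin N,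
      schur s (fun z => P.generator N T T (e x) (z.1, -z.2)) (P.generator N T T (e y)) =
        s * cov (e x) (e y) + (if x = y ∧ (x.val = 0 ∨ x.val = N - 1) then P.γ * T ^ 2 else 0) -
          ∑ u : Fin N, ∑ v : Fin N, cov (e x) (e u) * (G s)⁻¹ u v * cov (e v) (e y) := by
  intro hFI ω₂ lam β γ hω hl hβ hγ T hT N hN P X μ corr lap cov e G schur s hs x y
  obtain ⟨-, hFI2, -, hGp⟩ := hFI ω₂ lam β γ hω hl hβ hγ T hT N hN
  exact schur_generator_eq_pkg (ω₂ := ω₂) (lam := lam) (β := β) (γ := γ) (N := N) (T := T)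
    (corr := corr) (lap := lap) (cov := cov) (e := e)
    (fun f => Iff.rfl) (fun s f g => rfl) (fun f g => rfl) (fun x z => rfl) hFI2
    (fun x z => generatorSiteEnergy_proof ω₂ lam β γ N hN T T x z)
    (fun x y => ((parityStatics_proof ω₂ lam β γ hω hl hβ hγ T hT N hN) x).2 y)
    hω hl.le hβ.le hT hs (G s) (fun x y => rfl) (schur s) (fun f g => rfl) (hGp s hs) x y

end Summit.AtomisticToContinuum.FouriersLaw.Theorems.HonestZwanzig

end
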